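import Mathlib
import Summits.KontsevichZagierPeriods.KontsevichZagierPeriods.Theorems.SoloInformedZetaFourPieces
import HarnessLib
import HarnessLib.Audit

/-!
# SoloInformed — weight 4: the sum formula `ζ(3,1) + ζ(2,2) = ζ(4)` in the formal period ring

Solo programme `solo-KontsevichZagierPeriods-informed`, session s45 (PART XVI, kernel form of
the weight-4 instance of THEOREM XXXIII). The star side of the telescope step,
`R₂ = [(0,1)⁴, 1/((1 − x₀x₁x₂)(1 − x₀x₁x₂x₃))]` (the Kaneko–Yamamoto integral of `ζ⋆(3,1)`), splits
by partial fractions (rule (1b)) into `[(0,1)⁴, x₀x₁x₂/((1−x₀x₁x₂)(1−x₀x₁x₂x₃))] + [(0,1)⁴,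
1/(1−x₀x₁x₂x₃)]`, and the monomial map `κ(x) = (x₀, x₀x₁, x₀x₁x₂, x₀x₁x₂x₃)` (rule (2)) carries these
to Kontsevich's simplex representations `mzvRep [3,1]` and `mzvRep [4]`. With the garland side
(`SoloInformedZetaFourPieces`: `R₁ ≡ Z(2,2) + Z(3,1) + Z(3,1)`) and the telescope step
`[R₁] − [R₂] ∈ relations` (`soloInformed_z4_telescope`):

* `soloInformed_sumFormula4_mem_relations : [Z(3,1)] + [Z(2,2)] − [Z(4)] ∈ KZ.relations`,
* `soloInformed_mzvClass_sumFormula4 : mzvClass [3,1] + mzvClass [2,2] = mzvClass [4]` in `𝒫`,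
* (its `evalP`-shadow `ζ(3,1) + ζ(2,2) = ζ(4)` is the Literature's `multipleZeta_three_one_add_two_two`).

The weight-4 sum formula is NOT a consequence of finite double shuffle + duality in weight 4
(corank 2, THEOREM XXXIV); the kernel thus certifies an abstract-period identity among MZV classes
that the obvious "naive" relation families miss, obtained by the four Kontsevich–Zagier rules alone.

References: Kontsevich–Zagier 2001 §1.2 [KontsevichZagier2001]; M. Kaneko, S. Yamamoto,
arXiv:1605.03117 (integral-series identity); Granville 1997 / Zagier (sum formula).
-/

noncomputable section

open MeasureTheory Set MvPolynomial
open Literature.ModelTheory.ExponentialFields Literature.NumberTheory.Transcendental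
open Literature.NumberTheory.Transcendental.KZ

namespace Summit.KontsevichZagierPeriods.KontsevichZagierPeriods.Theorems

/-! ## 1. The monomial map `κ` on `(0,1)⁴` -/

/-- `det J_κ(x) = x₀³x₁²x₂`. -/
theorem soloInformed_kappa4_det (x : Fin 4 → ℝ) :
    (soloInformedJacCLM (soloInformedMonoPoly 4) x).det = x 0 * x 0 * x 0 * x 1 * x 1 * x 2 := by
  have h0 : (Finset.univ.filter fun l : Fin 4 => l < 0) = ∅ := by decide
  have h1 : (Finset.univ.filter fun l : Fin 4 => l < 1) = {0} := by decide
  have h2 : (Finset.univ.filter fun l : Fin 4 => l < 2) = {0, 1} := by decide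
  have h3 : (Finset.univ.filter fun l : Fin 4 => l < 3) = {0, 1, 2} := by decide
  rw [soloInformed_det_jacCLM_kappa, Fin.prod_univ_four, h0, h1, h2, h3]
  simp [Finset.prod_insert]
  ring

/-- `κ(x) = (x₀, x₀x₁, x₀x₁x₂, x₀x₁x₂x₃)`. -/
theorem soloInformed_kappa4_apply (x : Fin 4 → ℝ) :
    soloInformedKappaMap 4 x 0 = x 0 ∧ soloInformedKappaMap 4 x 1 = x 0 * x 1 ∧
    soloInformedKappaMap 4 x 2 = x 0 * x 1 * x 2 ∧
    soloInformedKappaMap 4 x 3 = x 0 * x 1 * x 2 * x 3 := by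
  have h0 : (Finset.univ.filter fun l : Fin 4 => l ≤ 0) = {0} := by decide
  have h1 : (Finset.univ.filter fun l : Fin 4 => l ≤ 1) = {0, 1} := by decide
  have h2 : (Finset.univ.filter fun l : Fin 4 => l ≤ 2) = {0, 1, 2} := by decide
  have h3 : (Finset.univ.filter fun l : Fin 4 => l ≤ 3) = {0, 1, 2, 3} := by decide
  simp only [soloInformedKappa_apply, soloInformedPrefixProd, h0, h1, h2, h3]
  simp [Finset.prod_insert, mul_assoc]

/-- `κ((0,1)⁴) = KZ.openOrderedSimplex 4`. -/
theorem soloInformed_image_kappa4 :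
    soloInformedKappaMap 4 '' soloInformedOpenCube 4 = openOrderedSimplex 4 := by
  rw [soloInformed_image_kappa, soloInformed_ordSimplex4_eq]

/-! ## 2. The star side: `S = p₁ + p₂` on `(0,1)⁴` -/

/-- `p₁(x) = x₀x₁x₂/((1 − x₀x₁x₂)(1 − x₀x₁x₂x₃))` (written with the factor order of the datum). -/
def soloInformedZ4p1 (x : Fin 4 → ℝ) : ℝ :=
  x 1 * x 2 * x 0 / ((1 - x 1 * x 2 * x 0) * (1 - x 1 * x 2 * x 0 * x 3))

/-- `p₂(x) = 1/(1 − x₀x₁x₂x₃)`. -/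
def soloInformedZ4p2 (x : Fin 4 → ℝ) : ℝ := 1 / (1 - x 1 * x 2 * x 0 * x 3)

section bounds
variable {x : Fin 4 → ℝ}

/-- `S = p₁ + p₂`. -/
theorem soloInformed_Z4FS_eq_p1_add_p2 (hx : x ∈ soloInformedOpenCube 4) :
    soloInformedZ4Datum.R2.integrand x = soloInformedZ4p1 x + soloInformedZ4p2 x := by
  rw [soloInformedZ4_R2_integrand, soloInformedZ4p1, soloInformedZ4p2]
  set a := 1 - x 1 * x 2 * x 0 with ha_def
  set b := 1 - x 1 * x 2 * x 0 * x 3 with hb_def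
  have ha : a ≠ 0 := (soloInformed_Z4_one_sub_pos hx).ne'
  have hb : b ≠ 0 := (soloInformed_Z4_one_sub_pos' hx).ne'
  field_simp
  rw [ha_def]; ring

/-- `0 ≤ p₁ ≤ S`. -/
theorem soloInformedZ4p1_bounds (hx : x ∈ soloInformedOpenCube 4) :
    0 ≤ soloInformedZ4p1 x ∧ soloInformedZ4p1 x ≤ soloInformedZ4Datum.R2.integrand x := by
  have ha := soloInformed_Z4_one_sub_pos hx
  have hb := soloInformed_Z4_one_sub_pos' hx
  have hp : 0 < x 1 * x 2 * x 0 := mul_pos (mul_pos (hx 1).1 (hx 2).1) (hx 0).1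
  rw [soloInformedZ4_R2_integrand, soloInformedZ4p1]
  exact ⟨div_nonneg hp.le (mul_pos ha hb).le,
    div_le_div_of_nonneg_right (by linarith) (mul_pos ha hb).le⟩

/-- `0 ≤ p₂ ≤ S`. -/
theorem soloInformedZ4p2_bounds (hx : x ∈ soloInformedOpenCube 4) :
    0 ≤ soloInformedZ4p2 x ∧ soloInformedZ4p2 x ≤ soloInformedZ4Datum.R2.integrand x := by
  have ha := soloInformed_Z4_one_sub_pos hx
  have hb := soloInformed_Z4_one_sub_pos' hx
  have hp : 0 < x 1 * x 2 * x 0 := mul_pos (mul_pos (hx 1).1 (hx 2).1) (hx 0).1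
  rw [soloInformedZ4_R2_integrand, soloInformedZ4p2]
  exact ⟨(one_div_pos.2 hb).le, one_div_le_one_div_of_le (mul_pos ha hb)
    (mul_le_of_le_one_left hb.le (by linarith))⟩

/-- The pull-back identity `p₁(x) = Z(3,1)(κ x) · |det J_κ(x)|`. -/
theorem soloInformedZ4p1_kappa (hx : x ∈ soloInformedOpenCube 4) :
    soloInformedZ4p1 x = soloInformedZ31.integrand (soloInformedKappaMap 4 x) *
      |(soloInformedJacCLM (soloInformedMonoPoly 4) x).det| := by
  obtain ⟨k0, k1, k2, k3⟩ := soloInformed_kappa4_apply x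
  have h0 := hx 0; have h1 := hx 1; have h2 := hx 2
  rw [soloInformedZ31_integrand, k0, k1, k2, k3, soloInformed_kappa4_det,
    abs_of_pos (by have := h0.1; have := h1.1; have := h2.1; positivity :
      0 < x 0 * x 0 * x 0 * x 1 * x 1 * x 2), soloInformedZ4p1]
  set a := 1 - x 1 * x 2 * x 0 with ha_def
  set b := 1 - x 1 * x 2 * x 0 * x 3 with hb_def
  have ha : a ≠ 0 := (soloInformed_Z4_one_sub_pos hx).ne'
  have hb : b ≠ 0 := (soloInformed_Z4_one_sub_pos' hx).ne'
  have hy : x 0 ≠ 0 := h0.1.ne'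
  have hu : x 1 ≠ 0 := h1.1.ne'
  rw [show 1 - x 0 * x 1 * x 2 = a by rw [ha_def]; ring,
    show 1 - x 0 * x 1 * x 2 * x 3 = b by rw [hb_def]; ring]
  field_simp

/-- The pull-back identity `p₂(x) = Z(4)(κ x) · |det J_κ(x)|`. -/
theorem soloInformedZ4p2_kappa (hx : x ∈ soloInformedOpenCube 4) :
    soloInformedZ4p2 x = soloInformedZ4.integrand (soloInformedKappaMap 4 x) *
      |(soloInformedJacCLM (soloInformedMonoPoly 4) x).det| := by
  obtain ⟨k0, k1, k2, k3⟩ := soloInformed_kappa4_apply x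
  have h0 := hx 0; have h1 := hx 1; have h2 := hx 2
  rw [soloInformedZ4_integrand, k0, k1, k2, k3, soloInformed_kappa4_det,
    abs_of_pos (by have := h0.1; have := h1.1; have := h2.1; positivity :
      0 < x 0 * x 0 * x 0 * x 1 * x 1 * x 2), soloInformedZ4p2]
  set b := 1 - x 1 * x 2 * x 0 * x 3 with hb_def
  have hb : b ≠ 0 := (soloInformed_Z4_one_sub_pos' hx).ne'
  have hy : x 0 ≠ 0 := h0.1.ne'
  have hu : x 1 ≠ 0 := h1.1.ne'
  have hw : x 2 ≠ 0 := h2.1.ne'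
  rw [show 1 - x 0 * x 1 * x 2 * x 3 = b by rw [hb_def]; ring]
  field_simp

end bounds

/-- Continuity of `p₁` on the cube. -/
theorem soloInformed_continuousOn_Z4p1 : ContinuousOn soloInformedZ4p1 (soloInformedOpenCube 4) := by
  refine ContinuousOn.div (Continuous.continuousOn (by fun_prop))
    (Continuous.continuousOn (by fun_prop)) fun x hx => ?_
  exact (mul_pos (soloInformed_Z4_one_sub_pos hx) (soloInformed_Z4_one_sub_pos' hx)).ne'

/-- Continuity of `p₂` on the cube. -/
theorem soloInformed_continuousOn_Z4p2 : ContinuousOn soloInformedZ4p2 (soloInformedOpenCube 4) := by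
  refine ContinuousOn.div continuousOn_const (Continuous.continuousOn (by fun_prop)) fun x hx => ?_
  exact (soloInformed_Z4_one_sub_pos' hx).ne'

/-- Integrability of `p₁` (dominated by `S`). -/
theorem soloInformed_integrableOn_Z4p1 : IntegrableOn soloInformedZ4p1 (soloInformedOpenCube 4) := by
  refine soloInformed_integrableOn_of_le_W (soloInformed_measurableSet_openCube 4) subset_rfl
    soloInformed_continuousOn_Z4p1 soloInformedZ4E2 soloInformedZ4E2_lt_one 1 fun x hx => ?_
  rw [one_mul, abs_of_nonneg (soloInformedZ4p1_bounds hx).1]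
  refine (soloInformedZ4p1_bounds hx).2.trans ?_
  rw [soloInformedZ4_R2_integrand]; exact soloInformed_Z4FS_le_W hx

/-- Integrability of `p₂` (dominated by `S`). -/
theorem soloInformed_integrableOn_Z4p2 : IntegrableOn soloInformedZ4p2 (soloInformedOpenCube 4) := by
  refine soloInformed_integrableOn_of_le_W (soloInformed_measurableSet_openCube 4) subset_rfl
    soloInformed_continuousOn_Z4p2 soloInformedZ4E2 soloInformedZ4E2_lt_one 1 fun x hx => ?_
  rw [one_mul, abs_of_nonneg (soloInformedZ4p2_bounds hx).1]
  refine (soloInformedZ4p2_bounds hx).2.trans ?_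
  rw [soloInformedZ4_R2_integrand]; exact soloInformed_Z4FS_le_W hx

/-- `P₁ = [(0,1)⁴, p₁]`. -/
def soloInformedZ4P1 : IntegralRep 4 where
  domain := soloInformedOpenCube 4
  integrand := soloInformedZ4p1
  isSemialgebraic_domain := isSemialgebraic_soloInformedOpenCube 4
  isSemialgebraicFunOn_integrand :=
    soloInformed_isSemialgebraicFunOn_quot (isSemialgebraic_soloInformedOpenCube 4) (X 1 * X 2 * X 0)
      ((1 - X 1 * X 2 * X 0) * (1 - X 1 * X 2 * X 0 * X 3)) _
      (fun x hx => by
        simpa using (mul_pos (soloInformed_Z4_one_sub_pos hx) (soloInformed_Z4_one_sub_pos' hx)).ne')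
      fun x _ => by simp [soloInformedZ4p1]
  integrableOn := soloInformed_integrableOn_Z4p1

/-- `P₂ = [(0,1)⁴, p₂]`. -/
def soloInformedZ4P2 : IntegralRep 4 where
  domain := soloInformedOpenCube 4
  integrand := soloInformedZ4p2
  isSemialgebraic_domain := isSemialgebraic_soloInformedOpenCube 4
  isSemialgebraicFunOn_integrand :=
    soloInformed_isSemialgebraicFunOn_quot (isSemialgebraic_soloInformedOpenCube 4) 1
      (1 - X 1 * X 2 * X 0 * X 3) _
      (fun x hx => by simpa using (soloInformed_Z4_one_sub_pos' hx).ne')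
      fun x _ => by simp [soloInformedZ4p2]
  integrableOn := soloInformed_integrableOn_Z4p2

/-! ## 3. The moves on the star side -/

/-- **(1b)** `[R₂] − [P₁] − [P₂] ∈ relations`. -/
theorem soloInformed_s_move1 :
    of soloInformedZ4Datum.R2 - of soloInformedZ4P1 - of soloInformedZ4P2 ∈ relations :=
  integrandAddRel_subset_relations ⟨4, soloInformedZ4Datum.R2, soloInformedZ4P1, soloInformedZ4P2,
    rfl, rfl, fun _ hx => soloInformed_Z4FS_eq_p1_add_p2 hx, rfl⟩

/-- **(2) along `κ`**: `[P₁] − [Z(3,1)] ∈ relations`. -/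
theorem soloInformed_s_move2 : of soloInformedZ4P1 - of soloInformedZ31 ∈ relations :=
  soloInformed_of_sub_of_mem_relations_polyMapCLM (soloInformedMonoPoly 4) soloInformedZ4P1
    soloInformedZ31 (soloInformed_injOn_kappa 4)
    (by rw [soloInformedZ31_domain]; exact soloInformed_image_kappa4.symm)
    fun x hx => soloInformedZ4p1_kappa hx

/-- **(2) along `κ`**: `[P₂] − [Z(4)] ∈ relations`. -/
theorem soloInformed_s_move3 : of soloInformedZ4P2 - of soloInformedZ4 ∈ relations :=
  soloInformed_of_sub_of_mem_relations_polyMapCLM (soloInformedMonoPoly 4) soloInformedZ4P2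
    soloInformedZ4 (soloInformed_injOn_kappa 4)
    (by rw [soloInformedZ4_domain]; exact soloInformed_image_kappa4.symm)
    fun x hx => soloInformedZ4p2_kappa hx

/-- **The star side assembled**: `[R₂] − ([Z(3,1)] + [Z(4)]) ∈ relations`
(the Kaneko–Yamamoto decomposition `ζ⋆(3,1) = ζ(3,1) + ζ(4)` inside `KZ.relations`). -/
theorem soloInformed_R2_sub_mzv :
    of soloInformedZ4Datum.R2 - (of soloInformedZ31 + of soloInformedZ4) ∈ relations := by
  have h : of soloInformedZ4Datum.R2 - (of soloInformedZ31 + of soloInformedZ4)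
      = (of soloInformedZ4Datum.R2 - of soloInformedZ4P1 - of soloInformedZ4P2)
        + (of soloInformedZ4P1 - of soloInformedZ31) + (of soloInformedZ4P2 - of soloInformedZ4) := by
    abel
  rw [h]
  exact relations.add_mem (relations.add_mem soloInformed_s_move1 soloInformed_s_move2)
    soloInformed_s_move3

/-! ## 4. The sum formula in weight 4 -/

/-- **THEOREM (weight-4 sum formula inside `KZ.relations`).**
`[Z(3,1)] + [Z(2,2)] − [Z(4)] ∈ KZ.relations`, where `Z(k) = KZ.mzvRep k` are Kontsevich's simplex
representations: obtained from the telescope step `[R₁] ≡ [R₂]`, the garland side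
`[R₁] ≡ [Z(2,2)] + 2[Z(3,1)]` and the star side `[R₂] ≡ [Z(3,1)] + [Z(4)]`. -/
theorem soloInformed_sumFormula4_mem_relations :
    of soloInformedZ31 + of soloInformedZ22 - of soloInformedZ4 ∈ relations := by
  have h : of soloInformedZ31 + of soloInformedZ22 - of soloInformedZ4
      = (of soloInformedZ4Datum.R1 - of soloInformedZ4Datum.R2)
        - (of soloInformedZ4Datum.R1 - (of soloInformedZ22 + of soloInformedZ31 + of soloInformedZ31))
        + (of soloInformedZ4Datum.R2 - (of soloInformedZ31 + of soloInformedZ4)) := by abel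
  rw [h]
  exact relations.add_mem (relations.sub_mem soloInformed_z4_telescope soloInformed_R1_sub_mzv)
    soloInformed_R2_sub_mzv

/-- **COROLLARY (the sum formula in the formal period ring `𝒫`).**
`mzvClass [3,1] + mzvClass [2,2] = mzvClass [4]`. -/
theorem soloInformed_mzvClass_sumFormula4 : mzvClass [3, 1] + mzvClass [2, 2] = mzvClass [4] := by
  rw [← soloInformed_toFormalPeriod_Z31, ← soloInformed_toFormalPeriod_Z22,
    ← soloInformed_toFormalPeriod_Z4, ← map_add, toFormalPeriod_eq_iff]
  exact soloInformed_sumFormula4_mem_relations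

/-! *Remark.* Applying `KZ.evalP` (`evalP_mzvClass`) gives back the numerical sum formula
`multipleZeta [3,1] + multipleZeta [2,2] = multipleZeta [4]`, which the Literature proves by series
manipulations (`multipleZeta_three_one_add_two_two`); the content here is its lift to the formal
period ring `𝒫`, i.e. that it follows from the three rules applied to the integral representations. -/

/-- **COROLLARY (an instance of the period conjecture decided by the rules).** The two rational
representations `Z(3,1) ⊔ Z(2,2)` … stated on classes: equality of the abstract periods
`⟦Z(3,1)⟧ + ⟦Z(2,2)⟧` and `⟦Z(4)⟧` holds in `𝒫` — unconditionally, i.e. without assuming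
`KZPeriodConjecture`. -/
theorem soloInformed_toFormalPeriod_sumFormula4 :
    toFormalPeriod (of soloInformedZ31 + of soloInformedZ22) = toFormalPeriod (of soloInformedZ4) :=
  toFormalPeriod_eq_iff.2 soloInformed_sumFormula4_mem_relations

end Summit.KontsevichZagierPeriods.KontsevichZagierPeriods.Theorems
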